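import Literature.NumberTheory.Transcendental.ZeroEstNullstellensatz
import Literature.RingTheory.KrullDimension.TangentDimension
import Literature.AlgebraicGeometry.Resolution.JacobianRegularLocus
import Mathlib.Analysis.Calculus.FDeriv.Analytic
import Mathlib.Analysis.Calculus.InverseFunctionTheorem.FDeriv
import Mathlib.Analysis.Calculus.Deriv.Comp
import Mathlib.Analysis.Calculus.Deriv.Prod
import Mathlib.Analysis.Calculus.Deriv.Add
import Mathlib.Analysis.Calculus.Deriv.Mul
import Mathlib.RingTheory.RegularLocalRing.Polynomial
import Mathlib.LinearAlgebra.Matrix.Rank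
import HarnessLib

/-!
# Zero estimates on commutative algebraic groups, III: `dim G = n`, and `G` is non-singular

Topic `Literature/NumberTheory/Transcendental`. Third module of the discharge of
`Literature.NumberTheory.Transcendental.philippon1986_std` through D. Roy's exposition of
Philippon's zero estimate (Nesterenko–Philippon (eds.), LNM 1752, Ch. 11) for an abstract analytic
group model `M : AnalyticGroupModel V N` (`ZeroEstModel.lean`, `ZeroEstNullstellensatz.lean`).
Here the three "algebraic completeness" fields of the structure are cashed:

* **`coneDim V = dim G + 1`** (`coneDim_univ`), i.e. `dim ℂ[X] ⧸ 𝔊 = n + 1`: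
  `≥` from the field `nondeg` — the `n` ratios `Θ_{J_i}/Θ_{J₀}` have injective, hence bijective,
  differential at `w₀`, so by the inverse function theorem
  (`HasStrictFDerivAt.map_nhds_eq_of_equiv`) a polynomial relation among `X_{J₀}, X_{J_1}, …,
  X_{J_n}` modulo `𝔊` would vanish on an open subset of `ℂ^{n+1}`, so `X_{J₀}, X_{J_i}` are
  algebraically independent modulo `𝔊` and `trdeg ≥ n + 1`
  (`Literature.RingTheory.KrullDimension.ringKrullDim_eq_trdeg`);
  `≤` from the field `locRel` — at a point `a = Θ(w)` of the cone the tangent space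
  `Literature.RingTheory.KrullDimension.tangentSpaceAt 𝔊 a` lies in the common kernel of `N - n` independent differentials,
  so has dimension `≤ n + 1`, and the height of the point in `ℂ[X] ⧸ 𝔊`, which is the dimension of
  this affine domain, is at most that
  (`Literature.RingTheory.KrullDimension.height_le_finrank_tangentSpaceAt`).
* `height 𝔊 = N - n` (`height_relIdeal`), and for a relevant homogeneous prime `𝔭 ⊇ 𝔊`:
  `coneDim Z_G(𝔭) + height 𝔭 = N + 1` specialised.
* **`G` is non-singular along the cone** (Roy, proof of Prop. 2.2, p. 203: "`𝔊ℂ[X]_M =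
  (P_1, …, P_r)ℂ[X]_M`"), in the form consumed by the Cohen–Macaulay chain of Prop. 2.2: for a
  relevant homogeneous prime `𝔭 ⊇ 𝔊`, **`𝔊 R_𝔭` is generated by `N - n` of the relations and
  `R_𝔭 ⧸ 𝔊R_𝔭` is a regular local ring** (`relIdeal_map_eq_span_and_isRegularLocalRing`) — the
  Jacobian criterion, Matsumura Thm. 30.4 (ii), PROVED in the tree
  (`Literature.AlgebraicGeometry.Resolution.Matsumura1987_30_4_ii`), fed with the derivations
  `D_i = ∑_J v_{iJ} ∂/∂X_J` dual to the gradients at a point of `Z_G(𝔭)` (`det(D_i P_j) = 1` there).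

Everything is PROVED.

## References

* Yu. V. Nesterenko, P. Philippon (eds.), *Introduction to Algebraic Independence Theory*,
  LNM 1752, Springer 2001, Ch. 11 (D. Roy), §2.2 (i), Prop. 2.2 (proof, p. 203).
  [NesterenkoPhilippon2001]
* H. Matsumura, *Commutative Ring Theory* (1986), Thm 5.6, Thm 30.4. [Matsumura1987]
-/

noncomputable section

open MvPolynomial Set Filter Topology
open scoped Pointwise

namespace Literature.NumberTheory.Transcendental

namespace AnalyticGroupModel

variable {V : Type*} [NormedAddCommGroup V] [NormedSpace ℂ V] [CompleteSpace V]
  {N : ℕ} (M : AnalyticGroupModel V N)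

attribute [local instance] MvPolynomial.gradedAlgebra

/-! ### A polynomial vanishing on a non-empty open set is zero -/

/-- **A polynomial over `ℂ` vanishing on a non-empty open subset of `ℂ^σ` is zero** (identity
theorem for the entire function it defines). [folklore] -/
theorem eq_zero_of_forall_eval_eq_zero_of_isOpen {σ : Type*} [Fintype σ] {Q : MvPolynomial σ ℂ}
    {U : Set (σ → ℂ)} (hU : IsOpen U) (hne : U.Nonempty) (h : ∀ z ∈ U, eval z Q = 0) : Q = 0 := by
  obtain ⟨z₀, hz₀⟩ := hne
  have han : AnalyticOnNhd ℂ (fun z : σ → ℂ => eval z Q) univ := AnalyticOnNhd.eval_mvPolynomial Q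
  have hev : (fun z : σ → ℂ => eval z Q) =ᶠ[𝓝 z₀] 0 :=
    Filter.eventually_of_mem (hU.mem_nhds hz₀) fun z hz => h z hz
  have hall := han.eqOn_zero_of_preconnected_of_eventuallyEq_zero isPreconnected_univ (mem_univ z₀) hev
  exact MvPolynomial.funext fun z => by simpa using hall (mem_univ z)

/-! ### The lower bound `dim ℂ[X]/𝔊 ≥ n + 1` from the non-degenerate point -/

section LowerBound

variable [FiniteDimensional ℂ V]

omit [CompleteSpace V] [FiniteDimensional ℂ V] in
/-- The ratio map `w ↦ (Θ_{J_i}(w) / Θ_{J₀}(w))_i` is analytic where `Θ_{J₀} ≠ 0`. [folklore] -/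
theorem analyticAt_ratio {dim' : ℕ} (J₀ : Fin (N + 1)) (Js : Fin dim' → Fin (N + 1)) {w : V}
    (hw : M.Θ J₀ w ≠ 0) :
    AnalyticAt ℂ (fun w i => M.Θ (Js i) w / M.Θ J₀ w) w := by
  refine analyticAt_pi_iff.mpr fun i => ?_
  exact ((M.analyticOnNhd_Θ (Js i)) w trivial).div ((M.analyticOnNhd_Θ J₀) w trivial) hw

/-- **`X_{J₀}, X_{J_1}, …, X_{J_n}` are algebraically independent modulo `𝔊`.** A polynomial
`Q(X_{J₀}, X_{J_i}) ∈ 𝔊` vanishes at every `c·Θ(w)`; writing `c Θ_{J_i}(w) = t · r_i(w)` with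
`t = c Θ_{J₀}(w)` and `r` the ratio map, which is open near `w₀` (inverse function theorem), `Q`
vanishes on the open set `{(t, t y) ; t ≠ 0, y ∈ r(U)}` of `ℂ^{n+1}`, hence is `0`.
[cite: NesterenkoPhilippon2001, Ch. 11 §2.2 (i) (dim G)] -/
theorem algebraicIndependent_ratioCoords :
    ∃ (J₀ : Fin (N + 1)) (Js : Fin M.dim → Fin (N + 1)),
      AlgebraicIndependent ℂ fun o : Option (Fin M.dim) =>
        Ideal.Quotient.mk M.relIdeal (X (o.elim J₀ Js) : MvPolynomial (Fin (N + 1)) ℂ) := by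
  classical
  obtain ⟨w₀, J₀, Js, hJ₀, hnd⟩ := M.nondeg
  refine ⟨J₀, Js, ?_⟩
  -- the ratio map and its derivative at `w₀`
  set r : V → (Fin M.dim → ℂ) := fun w i => M.Θ (Js i) w / M.Θ J₀ w with hr
  have hran : AnalyticAt ℂ r w₀ := M.analyticAt_ratio J₀ Js hJ₀
  have hstrict : HasStrictFDerivAt r (fderiv ℂ r w₀) w₀ := hran.hasStrictFDerivAt
  set r' : V →L[ℂ] (Fin M.dim → ℂ) := fderiv ℂ r w₀ with hr'
  -- injectivity of `r'` from `nondeg`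
  have hinj : Function.Injective r' := by
    refine (injective_iff_map_eq_zero _).mpr fun x hx => hnd x fun i => ?_
    have hline : HasDerivAt (fun t : ℂ => w₀ + t • x) x 0 := by
      simpa using ((hasDerivAt_id (0 : ℂ)).smul_const x).const_add w₀
    have hcomp : HasDerivAt (fun t : ℂ => r (w₀ + t • x)) (r' x) 0 := by
      have h := hstrict.hasFDerivAt
      rw [show w₀ = w₀ + (0 : ℂ) • x by simp] at h
      exact h.comp_hasDerivAt (0 : ℂ) hline
    have hi : HasDerivAt (fun t : ℂ => r (w₀ + t • x) i) (r' x i) 0 := by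
      have := (hasDerivAt_pi.mp hcomp) i
      exact this
    rw [hx] at hi
    simpa [hr] using hi.deriv
  -- `r'` is an equivalence
  have hdimV : Module.finrank ℂ V = Module.finrank ℂ (Fin M.dim → ℂ) := by
    rw [M.finrank_eq, Module.finrank_fin_fun]
  have hbij : Function.Bijective r' :=
    ⟨hinj, (LinearMap.injective_iff_surjective_of_finrank_eq_finrank hdimV).mp hinj⟩
  set e : V ≃L[ℂ] (Fin M.dim → ℂ) :=
    (LinearEquiv.ofBijective (r' : V →ₗ[ℂ] (Fin M.dim → ℂ)) hbij).toContinuousLinearEquiv with he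
  have hstrict' : HasStrictFDerivAt r (e : V →L[ℂ] (Fin M.dim → ℂ)) w₀ := by
    have : (e : V →L[ℂ] (Fin M.dim → ℂ)) = r' := by ext v; rfl
    rw [this]; exact hstrict
  have hmap : map r (𝓝 w₀) = 𝓝 (r w₀) := hstrict'.map_nhds_eq_of_equiv
  -- an open set `U ∋ w₀` on which `Θ_{J₀} ≠ 0`; its image is a neighbourhood of `r w₀`
  have hU : {w : V | M.Θ J₀ w ≠ 0} ∈ 𝓝 w₀ :=
    (M.analyticOnNhd_Θ J₀).continuous.isOpen_preimage _ isOpen_ne |>.mem_nhds hJ₀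
  have himg : r '' {w : V | M.Θ J₀ w ≠ 0} ∈ 𝓝 (r w₀) := by
    rw [← hmap]; exact image_mem_map hU
  obtain ⟨B, hBsub, hBopen, hBmem⟩ := mem_nhds_iff.mp himg
  -- algebraic independence
  rw [algebraicIndependent_iff]
  intro Q hQ
  -- `Q(X_{J₀}, X_{Js}) ∈ 𝔊`
  set ι : Option (Fin M.dim) → Fin (N + 1) := fun o => o.elim J₀ Js with hι
  have hmem : rename ι Q ∈ M.relIdeal := by
    rw [← Ideal.Quotient.eq_zero_iff_mem, ← Ideal.Quotient.mkₐ_eq_mk ℂ, ← AlgHom.comp_apply]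
    have hcomp : (Ideal.Quotient.mkₐ ℂ M.relIdeal).comp (rename ι) =
        aeval fun o => Ideal.Quotient.mk M.relIdeal (X (o.elim J₀ Js) : MvPolynomial (Fin (N + 1)) ℂ) := by
      refine MvPolynomial.algHom_ext fun o => ?_
      simp [hι]
    rw [hcomp, hQ]
  -- the open set `W = {z | z none ≠ 0, (z ∘ some)/(z none) ∈ B}` of `ℂ^{Option (Fin dim)}`
  set W : Set (Option (Fin M.dim) → ℂ) :=
    {z | z none ≠ 0 ∧ (fun i => z (some i) / z none) ∈ B} with hW
  have hWopen : IsOpen W := by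
    have h1 : IsOpen {z : Option (Fin M.dim) → ℂ | z none ≠ 0} :=
      isOpen_ne.preimage (continuous_apply none)
    have hcont : ContinuousOn (fun z : Option (Fin M.dim) → ℂ => fun i => z (some i) / z none)
        {z | z none ≠ 0} := by
      refine continuousOn_pi.mpr fun i => ?_
      exact ((continuous_apply (some i)).continuousOn).div (continuous_apply none).continuousOn
        fun z hz => hz
    exact hcont.isOpen_inter_preimage h1 hBopen
  have hWne : W.Nonempty := ⟨fun o => o.elim 1 (r w₀), one_ne_zero, by simpa using hBmem⟩
  -- `Q` vanishes on `W`
  have hvan : ∀ z ∈ W, eval z Q = 0 := by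
    rintro z ⟨hz0, hzB⟩
    obtain ⟨w, hw, hrw⟩ := hBsub hzB
    -- `z = c • (Θ_{ι o}(w))_o` with `c = z none / Θ_{J₀}(w)`
    have hΘ : M.Θ J₀ w ≠ 0 := hw
    set c : ℂ := z none / M.Θ J₀ w with hc
    have hz : z = (c • M.pt w) ∘ ι := by
      funext o
      rcases o with _ | i
      · simp [hι, hc, pt, div_mul_cancel₀ _ hΘ]
      · have hi : M.Θ (Js i) w / M.Θ J₀ w = z (some i) / z none := by
          have := congr_fun hrw i
          simpa [hr] using this
        have hi' : z (some i) = M.Θ (Js i) w / M.Θ J₀ w * z none := (div_eq_iff hz0).mp hi.symm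
        simp only [hι, Function.comp, Option.elim, Pi.smul_apply, smul_eq_mul, pt_apply]
        rw [hi', hc]
        field_simp
    have h1 := hmem w (mem_univ w) c
    rw [MvPolynomial.eval_rename] at h1
    rw [hz]
    exact h1
  exact eq_zero_of_forall_eval_eq_zero_of_isOpen hWopen hWne hvan

/-- **`dim G + 1 ≤ coneDim V`**, i.e. `n + 1 ≤ dim ℂ[X] ⧸ 𝔊`. [cite: NesterenkoPhilippon2001, Ch. 11 §2.2 (i)] -/
theorem dim_succ_le_coneDim_univ : M.dim + 1 ≤ M.coneDim (univ : Set V) := by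
  classical
  obtain ⟨J₀, Js, hind⟩ := M.algebraicIndependent_ratioCoords
  haveI := M.isPrime_relIdeal
  haveI : IsDomain (MvPolynomial (Fin (N + 1)) ℂ ⧸ M.relIdeal) := Ideal.Quotient.isDomain _
  have hdim := Literature.RingTheory.KrullDimension.ringKrullDim_eq_trdeg ℂ
    (MvPolynomial (Fin (N + 1)) ℂ ⧸ M.relIdeal)
  have htr := Literature.RingTheory.KrullDimension.trdeg_eq_toNat ℂ
    (MvPolynomial (Fin (N + 1)) ℂ ⧸ M.relIdeal)
  have hcard := hind.cardinalMk_le_trdeg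
  rw [Cardinal.mk_fintype, Fintype.card_option, Fintype.card_fin, htr] at hcard
  have hle : M.dim + 1 ≤ Cardinal.toNat (Algebra.trdeg ℂ (MvPolynomial (Fin (N + 1)) ℂ ⧸ M.relIdeal)) := by
    exact_mod_cast hcard
  have hcone := M.coneDim_eq (X := (univ : Set V)) univ_nonempty
  rw [show M.vanishing univ = M.relIdeal from rfl, hdim] at hcone
  have : M.coneDim (univ : Set V) = Cardinal.toNat (Algebra.trdeg ℂ (MvPolynomial (Fin (N + 1)) ℂ ⧸ M.relIdeal)) := by
    exact_mod_cast hcone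
  omega

end LowerBound

/-! ### The upper bound `dim ℂ[X]/𝔊 ≤ n + 1` from the Jacobian criterion -/

section UpperBound

/-- The linear map `v ↦ (∇P(a) · v)_{P ∈ S}` whose kernel contains the tangent space. [folklore] -/
def gradMap (S : Finset (MvPolynomial (Fin (N + 1)) ℂ)) (a : Fin (N + 1) → ℂ) :
    (Fin (N + 1) → ℂ) →ₗ[ℂ] (S → ℂ) :=
  Matrix.mulVecLin (Matrix.of fun (P : S) (J : Fin (N + 1)) => eval a (pderiv J (P : MvPolynomial _ ℂ)))

omit [CompleteSpace V] in
/-- `gradMap` applied. [folklore] -/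
theorem gradMap_apply (S : Finset (MvPolynomial (Fin (N + 1)) ℂ)) (a v : Fin (N + 1) → ℂ) (P : S) :
    gradMap S a v P = ∑ J, eval a (pderiv J (P : MvPolynomial _ ℂ)) * v J := by
  simp [gradMap, Matrix.mulVec, dotProduct]

omit [CompleteSpace V] in
/-- The tangent space of an ideal containing `S` lies in the kernel of `gradMap S`. [folklore] -/
theorem tangentSpaceAt_le_ker_gradMap {I : Ideal (MvPolynomial (Fin (N + 1)) ℂ)}
    {S : Finset (MvPolynomial (Fin (N + 1)) ℂ)} (hS : ∀ P ∈ S, P ∈ I) (a : Fin (N + 1) → ℂ) :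
    Literature.RingTheory.KrullDimension.tangentSpaceAt I a ≤ LinearMap.ker (gradMap S a) := by
  intro v hv
  rw [LinearMap.mem_ker]
  funext P
  rw [gradMap_apply]
  exact hv P (hS P P.2)

omit [CompleteSpace V] in
/-- If the gradients `∇P(a)`, `P ∈ S`, are linearly independent then `gradMap S a` is onto, and its
kernel has dimension `N + 1 - |S|`. [folklore] -/
theorem finrank_ker_gradMap {S : Finset (MvPolynomial (Fin (N + 1)) ℂ)} {a : Fin (N + 1) → ℂ}
    (hli : LinearIndependent ℂ fun P : S => fun J => eval a (pderiv J (P : MvPolynomial _ ℂ))) :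
    Module.finrank ℂ (LinearMap.ker (gradMap S a)) + S.card = N + 1 := by
  classical
  have hrank : Module.finrank ℂ (LinearMap.range (gradMap S a)) = S.card := by
    change Matrix.rank (Matrix.of fun (P : S) (J : Fin (N + 1)) => eval a (pderiv J (P : MvPolynomial _ ℂ))) = _
    rw [Matrix.rank_eq_finrank_span_row, finrank_span_eq_card]
    · simp
    · exact hli
  have h := LinearMap.finrank_range_add_finrank_ker (gradMap S a)
  rw [hrank, Module.finrank_fin_fun] at h
  omega

omit [CompleteSpace V] in
/-- **`coneDim V ≤ dim G + 1`**: at a point of the cone, `dim ℂ[X]/𝔊 = height of the point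
≤ dim (tangent space) ≤ n + 1`. [cite: NesterenkoPhilippon2001, Ch. 11 Prop. 2.2 (proof, p. 203)] -/
theorem coneDim_univ_le : M.coneDim (univ : Set V) ≤ M.dim + 1 := by
  classical
  obtain ⟨S, hShom, hSvan, hcard, hli⟩ := M.locRel 0
  set a : Fin (N + 1) → ℂ := M.pt 0 with ha
  have ha0 : ∀ f ∈ M.relIdeal, eval a f = 0 := fun f hf => by
    simpa [one_smul] using hf 0 (mem_univ _) 1
  -- tangent space bound
  have hS : ∀ P ∈ S, P ∈ M.relIdeal := fun P hP => by
    obtain ⟨d, hd⟩ := hShom P hP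
    exact (M.mem_relIdeal_iff_of_isHomogeneous hd).mpr fun w' => hSvan P hP w'
  have hT : Module.finrank ℂ (Literature.RingTheory.KrullDimension.tangentSpaceAt M.relIdeal a) ≤ M.dim + 1 := by
    have h1 := Submodule.finrank_mono (tangentSpaceAt_le_ker_gradMap hS a)
    have h2 := finrank_ker_gradMap (S := S) (a := a) hli
    omega
  -- the height of the point is the dimension of the affine domain `ℂ[X] ⧸ 𝔊`
  haveI := M.isPrime_relIdeal
  haveI : IsDomain (MvPolynomial (Fin (N + 1)) ℂ ⧸ M.relIdeal) := Ideal.Quotient.isDomain _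
  set φ := Literature.RingTheory.KrullDimension.pointOfZero M.relIdeal a ha0 with hφ
  set 𝔪 : Ideal (MvPolynomial (Fin (N + 1)) ℂ ⧸ M.relIdeal) := Literature.RingTheory.KrullDimension.pointIdeal φ with h𝔪
  have hsurj : Function.Surjective (φ : (MvPolynomial (Fin (N + 1)) ℂ ⧸ M.relIdeal) →+* ℂ) :=
    fun c => ⟨algebraMap ℂ _ c, by simp⟩
  haveI hmax : 𝔪.IsMaximal := by
    rw [h𝔪]
    exact RingHom.ker_isMaximal_of_surjective _ hsurj
  have hfield : ringKrullDim ((MvPolynomial (Fin (N + 1)) ℂ ⧸ M.relIdeal) ⧸ 𝔪) = 0 :=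
    ringKrullDim_eq_zero_of_isField ((Ideal.Quotient.maximal_ideal_iff_isField_quotient 𝔪).mp hmax)
  have hformula := Literature.RingTheory.KrullDimension.ringKrullDim_quotient_add_height ℂ
    (A := MvPolynomial (Fin (N + 1)) ℂ ⧸ M.relIdeal) 𝔪
  rw [hfield, zero_add] at hformula
  have hh := Literature.RingTheory.KrullDimension.height_le_finrank_tangentSpaceAt M.relIdeal a ha0
  -- assemble
  have hcone := M.coneDim_eq (X := (univ : Set V)) univ_nonempty
  rw [show M.vanishing univ = M.relIdeal from rfl, ← hformula] at hcone
  have h1 : (M.coneDim (univ : Set V) : ℕ∞) = 𝔪.height := by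
    have : ((M.coneDim (univ : Set V) : ℕ∞) : WithBot ℕ∞) = (𝔪.height : WithBot ℕ∞) := hcone
    exact_mod_cast this
  have h2 : (M.coneDim (univ : Set V) : ℕ∞) ≤ (Module.finrank ℂ (Literature.RingTheory.KrullDimension.tangentSpaceAt M.relIdeal a) : ℕ) := by
    rw [h1]; exact hh
  have h3 : M.coneDim (univ : Set V) ≤ Module.finrank ℂ (Literature.RingTheory.KrullDimension.tangentSpaceAt M.relIdeal a) := by
    exact_mod_cast h2
  exact h3.trans hT

end UpperBound

/-! ### `dim G`, `height 𝔊` -/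

section Dim

variable [FiniteDimensional ℂ V]

/-- **`coneDim V = dim G + 1`**, i.e. `dim ℂ[X₀, …, X_N] ⧸ 𝔊 = n + 1`.
[cite: NesterenkoPhilippon2001, Ch. 11 §2.2 (i)] -/
theorem coneDim_univ : M.coneDim (univ : Set V) = M.dim + 1 :=
  le_antisymm M.coneDim_univ_le M.dim_succ_le_coneDim_univ

/-- `dim ℂ[X] ⧸ 𝔊 = n + 1` as a Krull dimension. [folklore] -/
theorem ringKrullDim_quotient_relIdeal :
    ringKrullDim (MvPolynomial (Fin (N + 1)) ℂ ⧸ M.relIdeal) = (M.dim + 1 : ℕ) := by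
  rw [← M.coneDim_univ, show M.relIdeal = M.vanishing univ from rfl, ← M.coneDim_eq univ_nonempty]

/-- `n ≤ N`. [folklore] -/
theorem dim_le : M.dim ≤ N := by
  have := M.coneDim_le (univ : Set V)
  rw [M.coneDim_univ] at this
  omega

/-- **`height 𝔊 = N - n`.** [cite: NesterenkoPhilippon2001, Ch. 11 Prop. 2.2 (proof: rank 𝔊 = r)] -/
theorem height_relIdeal : M.relIdeal.height = (N - M.dim : ℕ) := by
  haveI := M.isPrime_relIdeal
  obtain ⟨m, hm, -⟩ := exists_height_eq M.relIdeal
  have h := M.coneDim_add_eq_of_height_eq (𝔭 := M.relIdeal) M.isHomogeneous_relIdeal le_rfl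
    (M.isRelevant_vanishing univ_nonempty) hm
  rw [zeroSet_relIdeal, M.coneDim_univ] at h
  rw [hm]
  congr 1
  omega

/-- The height of `𝔊 R_𝔭` in a localization at a prime `𝔭 ⊇ 𝔊`. [folklore] -/
theorem height_map_relIdeal {𝔭 : Ideal (MvPolynomial (Fin (N + 1)) ℂ)} [𝔭.IsPrime] (h𝔊 : M.relIdeal ≤ 𝔭) :
    (M.relIdeal.map (algebraMap (MvPolynomial (Fin (N + 1)) ℂ) (Localization.AtPrime 𝔭))).height =
      (N - M.dim : ℕ) := by
  haveI := M.isPrime_relIdeal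
  rw [IsLocalization.height_map_of_disjoint (M := 𝔭.primeCompl) M.relIdeal, M.height_relIdeal]
  exact Set.disjoint_left.mpr fun x hx hx' => hx (h𝔊 hx')

end Dim

/-! ### Non-singularity: the Jacobian criterion at relevant primes -/

section Jacobian

variable [FiniteDimensional ℂ V]

omit [CompleteSpace V] [FiniteDimensional ℂ V] in
/-- Dual vectors: for linearly independent `g_1, …, g_r ∈ ℂ^{N+1}` there are `v_1, …, v_r` with
`g_j · v_i = δ_{ij}` (coordinate functionals of the basis `g` of its span, extended to `ℂ^{N+1}`).
[folklore] -/
theorem exists_dual_vectors {r : ℕ} {g : Fin r → (Fin (N + 1) → ℂ)} (hg : LinearIndependent ℂ g) :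
    ∃ v : Fin r → (Fin (N + 1) → ℂ), ∀ i j, ∑ J, g j J * v i J = if i = j then 1 else 0 := by
  classical
  set b := Module.Basis.span hg with hbdef
  have hb : ∀ j, ((b j : Submodule.span ℂ (Set.range g)) : Fin (N + 1) → ℂ) = g j :=
    fun j => by rw [hbdef, Module.Basis.span_apply]
  choose φ hφ using fun i => LinearMap.exists_extend (b.coord i)
  refine ⟨fun i J => φ i (fun j' => if J = j' then (1 : ℂ) else 0), fun i j => ?_⟩
  have h1 : φ i (g j) = if i = j then 1 else 0 := by
    have hgj : g j = (Submodule.span ℂ (Set.range g)).subtype (b j) := by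
      rw [Submodule.subtype_apply, hb]
    rw [hgj, ← LinearMap.comp_apply, hφ, Module.Basis.coord_apply, Module.Basis.repr_self]
    by_cases hij : i = j
    · subst hij; simp
    · simp [hij]
  rw [← h1]
  conv_rhs => rw [pi_eq_sum_univ (g j), map_sum]
  simp only [map_smul, smul_eq_mul]

/-- The derivation `D_v = ∑_J v_J ∂/∂X_J` of the polynomial ring (as a `ℤ`-derivation): the
`ℂ`-derivation with `D_v(X_J) = v_J`. [folklore] -/
def dirDerivation (v : Fin (N + 1) → ℂ) :
    Derivation ℤ (MvPolynomial (Fin (N + 1)) ℂ) (MvPolynomial (Fin (N + 1)) ℂ) :=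
  (mkDerivation ℂ fun J => (C (v J) : MvPolynomial (Fin (N + 1)) ℂ)).restrictScalars ℤ

omit [CompleteSpace V] [FiniteDimensional ℂ V] in
/-- `D_v P = ∑_J v_J ∂_J P`. [folklore] -/
theorem dirDerivation_apply (v : Fin (N + 1) → ℂ) (P : MvPolynomial (Fin (N + 1)) ℂ) :
    dirDerivation v P = ∑ J, C (v J) * pderiv J P := by
  classical
  change mkDerivation ℂ (fun J => (C (v J) : MvPolynomial (Fin (N + 1)) ℂ)) P = _
  induction P using MvPolynomial.induction_on with
  | C c => simp [derivation_C]
  | add p q hp hq => simp only [map_add, hp, hq, mul_add, Finset.sum_add_distrib]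
  | mul_X p i hp =>
    rw [Derivation.leibniz, mkDerivation_X, hp, smul_eq_mul, smul_eq_mul]
    have : ∀ J, C (v J) * pderiv J (p * X i) =
        X i * (C (v J) * pderiv J p) + p * (C (v J) * Pi.single (M := fun _ => MvPolynomial _ ℂ) J 1 i) := by
      intro J
      rw [Derivation.leibniz, pderiv_X, smul_eq_mul, smul_eq_mul]
      ring
    simp only [this, Finset.sum_add_distrib, ← Finset.mul_sum]
    rw [add_comm (p * C (v i))]
    congr 1
    congr 1
    rw [Finset.sum_eq_single i]
    · simp
    · intro J _ hJ; simp [Pi.single_eq_of_ne hJ.symm]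
    · simp

/-- **`G` is non-singular at the relevant primes (Jacobian criterion, Matsumura Thm. 30.4 (ii))**:
for a relevant homogeneous prime `𝔭 ⊇ 𝔊` there are `N - n` relations `f_j ∈ 𝔊` with
`𝔊 R_𝔭 = (f_1, …, f_{N-n}) R_𝔭` and `R_𝔭 ⧸ 𝔊 R_𝔭` a regular local ring
(`R = ℂ[X₀, …, X_N]`). [cite: NesterenkoPhilippon2001, Ch. 11 Prop. 2.2 (proof, p. 203)]
[cite: Matsumura1987, Thm 30.4 (ii)] -/
theorem relIdeal_map_eq_span_and_isRegularLocalRing {𝔭 : Ideal (MvPolynomial (Fin (N + 1)) ℂ)}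
    [𝔭.IsPrime] (hhom : 𝔭.IsHomogeneous (homogeneousSubmodule (Fin (N + 1)) ℂ))
    (h𝔊 : M.relIdeal ≤ 𝔭) (hrel : M.IsRelevant 𝔭) :
    ∃ f : Fin (N - M.dim) → MvPolynomial (Fin (N + 1)) ℂ, (∀ j, f j ∈ M.relIdeal) ∧
      M.relIdeal.map (algebraMap _ (Localization.AtPrime 𝔭)) =
        Ideal.span (Set.range fun j => algebraMap _ (Localization.AtPrime 𝔭) (f j)) ∧
      IsRegularLocalRing (Localization.AtPrime 𝔭 ⧸
        M.relIdeal.map (algebraMap _ (Localization.AtPrime 𝔭))) := by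
  classical
  obtain ⟨w, hw⟩ := M.zeroSet_nonempty_of_isRelevant hhom h𝔊 hrel
  obtain ⟨S, hShom, hSvan, hcard, hli⟩ := M.locRel w
  set a : Fin (N + 1) → ℂ := M.pt w with ha
  -- enumerate `S`
  have hr : S.card = N - M.dim := by have := M.dim_le; omega
  set e : Fin (N - M.dim) ≃ S := (Finset.equivFinOfCardEq hr).symm with he
  set f : Fin (N - M.dim) → MvPolynomial (Fin (N + 1)) ℂ := fun j => (e j : MvPolynomial _ ℂ) with hf
  have hfS : ∀ j, f j ∈ S := fun j => (e j).2
  have hfrel : ∀ j, f j ∈ M.relIdeal := fun j => by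
    obtain ⟨d, hd⟩ := hShom _ (hfS j)
    exact (M.mem_relIdeal_iff_of_isHomogeneous hd).mpr fun w' => hSvan _ (hfS j) w'
  -- gradients and dual vectors
  set g : Fin (N - M.dim) → (Fin (N + 1) → ℂ) := fun j J => eval a (pderiv J (f j)) with hg
  have hgli : LinearIndependent ℂ g := by
    have := hli.comp e e.injective
    exact this
  obtain ⟨v, hv⟩ := exists_dual_vectors hgli
  set D : Fin (N - M.dim) → Derivation ℤ (MvPolynomial (Fin (N + 1)) ℂ) (MvPolynomial (Fin (N + 1)) ℂ) :=
    fun i => dirDerivation (v i) with hD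
  -- `det(D_i f_j)` evaluates to `1` at `a`, hence is not in `𝔭`
  have heval : ∀ i j, eval a (D i (f j)) = if i = j then 1 else 0 := by
    intro i j
    rw [hD, dirDerivation_apply, map_sum]
    simp only [map_mul, eval_C]
    rw [← hv i j]
    exact Finset.sum_congr rfl fun J _ => by rw [hg]; ring
  have hdet : (Matrix.of fun i j => D i (f j)).det ∉ 𝔭 := by
    intro hmem
    have h0 : eval a (Matrix.of fun i j => D i (f j)).det = 0 := by
      have := M.subset_vanishing_zeroSet (𝔭 : Set (MvPolynomial (Fin (N + 1)) ℂ)) hmem w hw 1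
      rwa [one_smul] at this
    rw [RingHom.map_det] at h0
    have h1 : (RingHom.mapMatrix (eval a)) (Matrix.of fun i j => D i (f j)) = 1 := by
      ext i j
      simp [RingHom.mapMatrix_apply, heval, Matrix.one_apply]
    rw [h1, Matrix.det_one] at h0
    exact one_ne_zero h0
  -- Matsumura 30.4 (ii)
  have hreg : IsRegularLocalRing (Localization.AtPrime 𝔭) := inferInstance
  have h304 := Literature.AlgebraicGeometry.Resolution.Matsumura1987_30_4_ii 𝔭 hreg M.relIdeal
    (M.height_map_relIdeal h𝔊) D f hfrel h𝔊 hdet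
  exact ⟨f, hfrel, h304.1, h304.2⟩

end Jacobian


end AnalyticGroupModel

end Literature.NumberTheory.Transcendental
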